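import Summits.BirchSwinnertonDyer.BirchSwinnertonDyer.Theorems.BiquadraticEisensteinDescentHeegnerTwistCouplingInSupplyKrizLiCornerX12
import Summits.BirchSwinnertonDyer.BirchSwinnertonDyer.Theorems.PrintCFramJZeroThreeUnitRegimePrimePairInstances
import Summits.BirchSwinnertonDyer.BirchSwinnertonDyer.Theorems.PrintCFramJZeroThreeUnitRegimeOddAndFortyFourClasses
import Literature.NumberTheory.QuadraticFields.ImaginaryQuadraticClassNumberValues
import HarnessLib

set_option linter.dupNamespace false -- `Summit.BirchSwinnertonDyer.BirchSwinnertonDyer.Theorems.…` (summit = sub, D-0017)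
set_option autoImplicit false

/-!
# Crux `HeegnerTwistCouplingInSupply` (stmt-BirchSwinnertonDyer-21381) — X12₊ ∪ QT27₊ at `q ≡ 11 (mod 12)` through the Kriz–Li door,
# KERNEL INSTANCES II: the two remaining KL3-regular primes `q ≡ 11 (mod 12)` below `250` — `q ∈ {167, 239}` (certificates `r = 71, 47`)

Route `BiquadraticEisensteinDescent` (cell `pub/bsd-wall`, width seat `bsd-wall-cm-bed-w4` g27; `--supports` 21381, helper). Completes
`…KrizLiCornerX12Instances.lean` (q ∈ {11, 23, 47, 59, 71, 107, 191}) so that EVERY KL3-regular prime `q ≡ 11 (mod 12)` below `250`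
(irregular: 83, 131, 179, 251) has its row: ★ `cruxOnX12Plus_167` (`r = 71`, `h(−71) = 7`, `S₁` of 47 428 terms), ★ `cruxOnX12Plus_239`
(`r = 47`, `h(−47) = 5`, 44 932 terms) — the CONCLUSION of crux 21381 at `(W, q)` for every globally minimal `W ≅ y² = x³ + q·m²` with bad
primes `⊂ {2, 3, q}`, `a₂(W) = 0` if good at `2`, `r_an(W) ≠ 0`, modulo `hKL` (Kriz–Li 1.20), `hGZ` (Gross–Zagier), `hHP` (Heegner points).

HONEST FRAMING: two more cells of one CM family pair; conditional on three REFEREED named facts; BSD / the crux / its stubs NOT proved.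
THEOREMS ONLY. Supports stmt-BirchSwinnertonDyer-21381. [cite: KrizLi2019, Thm. 1.20 (pp. 7–8), §1.5 (1)] [cite: Washington1997, Thm. 4.2]
[cite: GrossZagier1986, Thm. I.(6.3), V.§1–2] [cite: Cox2013, §7.B Thm. 7.7(ii)]
-/

noncomputable section

open scoped Classical NumberTheorySymbols

namespace Summit.BirchSwinnertonDyer.BirchSwinnertonDyer.Theorems.KrizLiCornerX12

open _root_.WeierstrassCurve NumberField
open Literature.NumberTheory.EllipticCurves Literature.NumberTheory.EllipticCurves.KrizLi2019
  Literature.NumberTheory.EllipticCurves.ModularForms Literature.NumberTheory.QuadraticFields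
  Literature.NumberTheory.QuadraticFields.Quadratic
  Summit.BirchSwinnertonDyer.Rank1Residual.X12.O11.RouteU
  Summit.BirchSwinnertonDyer.BirchSwinnertonDyer.Theorems.PrintCFram

/-! ## `(q, r) = (167, 71)` -/

set_option maxRecDepth 800000 in
/-- **CERTIFICATES for `(q, r) = (167, 71)`**: `3 ∤ S₁` (47428 terms), `3 ∣ S₂`, `9 ∤ S₂` (`decide +kernel`).
[cite: KrizLi2019, Thm. 1.20 (p. 8) and §1.5 (1)] [cite: Washington1997, Thm. 4.2] -/
theorem cert_167_71 :
    ¬ ((3 : ℤ) ∣ ∑ j ∈ Finset.range (4 * 167 * 71),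
      (ZMod.χ₄ (j : ZMod 4) * J((j : ℤ) | 167) : ℤ) * jacobiSym (j : ℤ) 71 * (j : ℤ)) ∧
    ((3 : ℤ) ∣ ∑ j ∈ Finset.range (4 * 167 * 3),
      (ZMod.χ₄ (j : ZMod 4) * J((j : ℤ) | 167) : ℤ) * jacobiSym (j : ℤ) 3 * (j : ℤ) ^ (0 + 1)) ∧
    ¬ ((3 : ℤ) ^ 2 ∣ ∑ j ∈ Finset.range (4 * 167 * 3),
      (ZMod.χ₄ (j : ZMod 4) * J((j : ℤ) | 167) : ℤ) * jacobiSym (j : ℤ) 3 * (j : ℤ) ^ (0 + 1)) := by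
  simp_rw [ZMod.χ₄_nat_eq_if_mod_four, jacobiSym_prime_eq_ite_nat 167 (by norm_num) (by norm_num),
    jacobiSym_prime_eq_ite_nat 71 (by norm_num) (by norm_num), jacobiSym_prime_eq_ite_nat 3 (by norm_num) (by norm_num)]
  refine ⟨?_, ?_, ?_⟩ <;> decide +kernel

/-- ★ **The X12₊/QT27₊ corner at `q = 167`** (certificate `r = 71`, `h(−71) = 7 < 167`): for every globally minimal
`W ≅ y² = x³ + 167·m²` (`167m²` sixth-power-free; `x³ + 167³` is `m = 167`, `27a^{(167)}` is `m = 668`) with bad primes `⊂ {2, 3, 167}`,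
`a₂(W) = 0` if good at `2`, `r_an(W) ≠ 0`: the CONCLUSION of crux 21381 at `(W, 167)`, modulo `hKL`, `hGZ`, `hHP` only.
[cite: KrizLi2019, Thm. 1.20 (pp. 7–8)] [cite: GrossZagier1986, Thm. I.(6.3), V.§1–2] -/
theorem cruxOnX12Plus_167 (hKL : thm120_padicLogHeegner_unit_of_bernoulli)
    (hGZ : ∀ (N : ℕ) [NeZero N] (W : WeierstrassCurve ℚ) (K : Type) [Field K] [NumberField K], gross_zagier N W K)
    (hHP : ∀ (W : WeierstrassCurve ℚ) (K : Type) [Field K] [NumberField K], exists_isHeegnerPoint W K)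
    (W : WeierstrassCurve ℚ) [W.IsElliptic] [W.IsGloballyMinimal] [NeZero (W.conductorNorm ℤ)]
    {m : ℤ} (hm : m ≠ 0) (hW : ∃ C : VariableChange ℚ, C • W = mordellCurve ((167 : ℚ) * (m : ℚ) ^ 2))
    (h6 : ∀ ℓ : ℕ, ℓ.Prime → ¬ ((ℓ : ℤ) ^ 6 ∣ (167 : ℤ) * m ^ 2))
    (h2 : (haveI : Fact (Nat.Prime 2) := ⟨Nat.prime_two⟩; W.HasGoodReductionAtPrime 2) → W.LFunction 2 = 0)
    (hS : ∀ ℓ : ℕ, (hℓ : ℓ.Prime) → ¬ (haveI := Fact.mk hℓ; W.HasGoodReductionAtPrime ℓ) → ℓ = 2 ∨ ℓ = 3 ∨ ℓ = 167)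
    (hr1 : W.analyticRank ≠ 0) :
    ∃ (K : Type) (_ : Field K) (_ : NumberField K),
      IsImaginaryQuadratic K ∧ 4 < (NumberField.discr K).natAbs ∧
      SatisfiesHeegnerHypothesis (W.conductorNorm ℤ) K ∧
      (W.quadraticTwist (NumberField.discr K : ℚ)).entireLFunction 1 ≠ 0 ∧ ¬ 167 ∣ NumberField.classNumber K := by
  haveI : Fact (Nat.Prime 167) := ⟨by norm_num⟩
  haveI : Fact (Nat.Prime 71) := ⟨by norm_num⟩
  exact exists_cruxConclusion_of_prime_pair_three_mod_four hKL hGZ hHP (q := 167) (r := 71) (by norm_num) (by norm_num)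
    (by norm_num) (by norm_num) (by norm_num) (by norm_num) cert_167_71.1 cert_167_71.2.1 cert_167_71.2.2
    ClassNumberValues.classNumber_neg71 (by norm_num) W hm (by exact_mod_cast hW) (by exact_mod_cast h6) h2 hS hr1

/-! ## `(q, r) = (239, 47)` -/

set_option maxRecDepth 800000 in
/-- **CERTIFICATES for `(q, r) = (239, 47)`**: `3 ∤ S₁` (44932 terms), `3 ∣ S₂`, `9 ∤ S₂` (`decide +kernel`).
[cite: KrizLi2019, Thm. 1.20 (p. 8) and §1.5 (1)] [cite: Washington1997, Thm. 4.2] -/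
theorem cert_239_47 :
    ¬ ((3 : ℤ) ∣ ∑ j ∈ Finset.range (4 * 239 * 47),
      (ZMod.χ₄ (j : ZMod 4) * J((j : ℤ) | 239) : ℤ) * jacobiSym (j : ℤ) 47 * (j : ℤ)) ∧
    ((3 : ℤ) ∣ ∑ j ∈ Finset.range (4 * 239 * 3),
      (ZMod.χ₄ (j : ZMod 4) * J((j : ℤ) | 239) : ℤ) * jacobiSym (j : ℤ) 3 * (j : ℤ) ^ (0 + 1)) ∧
    ¬ ((3 : ℤ) ^ 2 ∣ ∑ j ∈ Finset.range (4 * 239 * 3),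
      (ZMod.χ₄ (j : ZMod 4) * J((j : ℤ) | 239) : ℤ) * jacobiSym (j : ℤ) 3 * (j : ℤ) ^ (0 + 1)) := by
  simp_rw [ZMod.χ₄_nat_eq_if_mod_four, jacobiSym_prime_eq_ite_nat 239 (by norm_num) (by norm_num),
    jacobiSym_prime_eq_ite_nat 47 (by norm_num) (by norm_num), jacobiSym_prime_eq_ite_nat 3 (by norm_num) (by norm_num)]
  refine ⟨?_, ?_, ?_⟩ <;> decide +kernel

/-- ★ **The X12₊/QT27₊ corner at `q = 239`** (certificate `r = 47`, `h(−47) = 5 < 239`): for every globally minimal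
`W ≅ y² = x³ + 239·m²` (`239m²` sixth-power-free; `x³ + 239³` is `m = 239`, `27a^{(239)}` is `m = 956`) with bad primes `⊂ {2, 3, 239}`,
`a₂(W) = 0` if good at `2`, `r_an(W) ≠ 0`: the CONCLUSION of crux 21381 at `(W, 239)`, modulo `hKL`, `hGZ`, `hHP` only.
[cite: KrizLi2019, Thm. 1.20 (pp. 7–8)] [cite: GrossZagier1986, Thm. I.(6.3), V.§1–2] -/
theorem cruxOnX12Plus_239 (hKL : thm120_padicLogHeegner_unit_of_bernoulli)
    (hGZ : ∀ (N : ℕ) [NeZero N] (W : WeierstrassCurve ℚ) (K : Type) [Field K] [NumberField K], gross_zagier N W K)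
    (hHP : ∀ (W : WeierstrassCurve ℚ) (K : Type) [Field K] [NumberField K], exists_isHeegnerPoint W K)
    (W : WeierstrassCurve ℚ) [W.IsElliptic] [W.IsGloballyMinimal] [NeZero (W.conductorNorm ℤ)]
    {m : ℤ} (hm : m ≠ 0) (hW : ∃ C : VariableChange ℚ, C • W = mordellCurve ((239 : ℚ) * (m : ℚ) ^ 2))
    (h6 : ∀ ℓ : ℕ, ℓ.Prime → ¬ ((ℓ : ℤ) ^ 6 ∣ (239 : ℤ) * m ^ 2))
    (h2 : (haveI : Fact (Nat.Prime 2) := ⟨Nat.prime_two⟩; W.HasGoodReductionAtPrime 2) → W.LFunction 2 = 0)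
    (hS : ∀ ℓ : ℕ, (hℓ : ℓ.Prime) → ¬ (haveI := Fact.mk hℓ; W.HasGoodReductionAtPrime ℓ) → ℓ = 2 ∨ ℓ = 3 ∨ ℓ = 239)
    (hr1 : W.analyticRank ≠ 0) :
    ∃ (K : Type) (_ : Field K) (_ : NumberField K),
      IsImaginaryQuadratic K ∧ 4 < (NumberField.discr K).natAbs ∧
      SatisfiesHeegnerHypothesis (W.conductorNorm ℤ) K ∧
      (W.quadraticTwist (NumberField.discr K : ℚ)).entireLFunction 1 ≠ 0 ∧ ¬ 239 ∣ NumberField.classNumber K := by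
  haveI : Fact (Nat.Prime 239) := ⟨by norm_num⟩
  haveI : Fact (Nat.Prime 47) := ⟨by norm_num⟩
  exact exists_cruxConclusion_of_prime_pair_three_mod_four hKL hGZ hHP (q := 239) (r := 47) (by norm_num) (by norm_num)
    (by norm_num) (by norm_num) (by norm_num) (by norm_num) cert_239_47.1 cert_239_47.2.1 cert_239_47.2.2
    ClassNumberValues.classNumber_neg47 (by norm_num) W hm (by exact_mod_cast hW) (by exact_mod_cast h6) h2 hS hr1

end Summit.BirchSwinnertonDyer.BirchSwinnertonDyer.Theorems.KrizLiCornerX12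

end
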